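import Literature.NumberTheory.Automorphic.ProjectiveDescentLatticeLevels                     -- ★ (W2)-CORE (A)(B)(C) (this seat)
import Literature.NumberTheory.Automorphic.UnitaryTwoAntidiagProjectiveDescent                  -- ★ p843570 (W1): `det_mul_map_det_eq_one_of_mem_unitaryGroupOfForm_antidiag_two`
import Literature.NumberTheory.Automorphic.ValuedFieldValuativeRelBridge                        -- ★ `mem_glInt_iff_forall_v_le_one`, `v_le_one_iff_mem_integer`, `v_eq_one_iff_valuation_eq_one`
import Literature.NumberTheory.Automorphic.HeckeTransversalGL                                   -- ★ `IsIntegralMatrix`, `mem_glInt_of_isIntegralMatrix`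
import Literature.NumberTheory.Automorphic.Liu2021.LemD1AsPrintedIndexedNonVacuityRamifiedPlace -- ★ `ramificationIdx'_eq_two_of_ne_one`
import HarnessLib

/-!
# Projective descent and lattice levels — dischargers: the `GL₂(𝒪)` bridge, diagonal bookkeeping, `|det u| = 1` on `U(σ, Φ₂)`, `e = 2` at a ramified place
(Serre, *Trees* II.1.1–1.3; Tits (1979) §2.7, §3.9; Rogawski (1990) §3.6)

Topic `NumberTheory/Automorphic`; namespaces `Literature.NumberTheory.Automorphic` (§1–§2) and `…Automorphic.UnitaryGroup` (§3–§4).  KERNEL mathematics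
only: theorems, no definition, no named fact, no instance, no notation, no `sorry`.  Cell `pub/hodgecm-mathlib`, F0∕P3a, crux H413 =
`stmt-HodgeConjecture-24833`, line «N6nsGerm», residue «R2EP-wild», ROAD W brick **(W2)-CORE**, companion of ★ `ProjectiveDescentLatticeLevels` (the
VERTEX∕EDGE level criteria (A)(B)(C) for `M = s · ι(g)`); seat F0P3a-p04 (g14).  HONEST LABEL: HC_CM is proved only modulo the printed citations until
rung 0 closes; nothing printed is asserted here.

CONTENTS — the hypotheses of (A)(B) discharged in the consumer's currency ((W2), B-p08 (g28): `K = U ∩ GL₂(𝒪_E)`, `K♯_D = U ∩ D GL₂(𝒪_E) D⁻¹`,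
`D = diag(1,η)`, membership read through ★ `mem_comap_map_conj_glInt_iff`):
* §1 `mem_glInt_iff_forall_v_le_one_of_v_det_eq_one`: `v(det g) = 1 ⟹ (g ∈ glInt n K ↔ all entries have v ≤ 1)`;
  `exists_mem_glInt_coe_eq_of_forall_v_le_one`: an integral matrix with unit determinant IS an element of `glInt`.
* §2 diagonal bookkeeping: `forall_v_conj_diagonal_le_one_iff_of_v_eq` (the test `diag(1,a)⁻¹ M diag(1,a)` integral depends only on `v a`),
  `…_of_v_eq_one` (unit `a`: same as `M` integral), `diagonal_inv_mul_conj_diagonal_mul_diagonal` (`u = d_α⁻¹ (d_α u d_α⁻¹) d_α`),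
  `diagonal_inv_mul_conj_diagonal_inv_mul_diagonal` (`d_η⁻¹ (d_α⁻¹ M d_α) d_η = d_{αη}⁻¹ M d_{αη}`).
* §3 `v_det_eq_one_of_mem_unitaryGroupOfForm_antidiag_two` (`|det u| = 1` on `U(σ,Φ₂)` for valuation-preserving `σ`, from ★
  `det_mul_map_det_eq_one_…`), `v_det_conj_diagonal_eq_one_of_mem_unitaryGroupOfForm_antidiag_two` (the hypothesis `hdet` of (A)(B) for
  `M = diag(1,α) u diag(1,α)⁻¹`; at a place `hσv` = ★ `valued_galAdicCompletionMap`).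
* §4 at a non-split RAMIFIED place `w ∣ v` of a quadratic extension of number fields: `valued_toPlace_eq_pow_two_of_ramified` (the hypothesis `hι` of (B):
  `v_w(ι_w y) = v_v(y)²`, ★ `valued_toPlace` + ★ `ramificationIdx'_eq_two_of_ne_one`) and `ramificationIdx'_placesOver_ne_zero` (the `he` of (A) at any place).
DICTIONARY for (W2) (memo `F0/P3a/F0P3a-p04/g13/MEMO-R2wild.F0P3a-p04g13.md` (S4); `α` anti-fixed, `M = d_α u d_α⁻¹ = s · ι(g)` ★ p843570): `K`-test =
«`d_α⁻¹ M d_α` integral», `K♯_{diag(1,η)}`-test = «`d_{αη}⁻¹ M d_{αη}` integral» (§2); `ord α = 0` ⟹ `K ↔ (A)` at `Λ₀`, `K♯ ↔ (B)` (edge `{Λ₀,Λ₁}`);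
`ord α = 1` ⟹ `K ↔ (B)`, `K♯ ↔ (A)` at `Λ₁ = diag(1,ϖ)Λ₀` via `v(αη) = v(ι ϖ)` and (C).  NOT here: the tree action and the stabiliser statements ((W1c)(W2)).

## References
* [Serre1980Trees] J.-P. Serre, *Trees* (1980), Ch. II §1.1–§1.3.
* [Tits1979] J. Tits, *Reductive groups over local fields*, PSPM 33.1 (1979), §2.7, §3.9.
* [Rogawski1990] J. D. Rogawski, *Automorphic Representations of Unitary Groups in Three Variables* (1990), §3.6 p. 31.
* [Serre1979] J.-P. Serre, *Local Fields* (1979), Ch. II §1.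
* [NeukirchANT1999] J. Neukirch, *Algebraic Number Theory* (1999), Ch. I §8 Prop. 8.2, Ch. II §6.
-/

set_option autoImplicit false

noncomputable section

open scoped WithZero Matrix MatrixGroups
open Matrix WithZero NumberField IsDedekindDomain

namespace Literature.NumberTheory.Automorphic

/-! ## §1 The `GL_n(𝒪)` bridge -/

section Bridge

variable {K : Type*} [Field K] [Valued K ℤᵐ⁰] [ValuativeRel K] [(Valued.v : Valuation K ℤᵐ⁰).Compatible]

/-- **`GL_n(𝒪)` by entries**: if `v(det g) = 1` then `g ∈ glInt n K ↔` all entries of `g` have `v ≤ 1` (the inverse is `det⁻¹ · adj`, ★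
`mem_glInt_of_isIntegralMatrix`). [cite: Serre1979, Ch. II §1] -/
theorem mem_glInt_iff_forall_v_le_one_of_v_det_eq_one {n : ℕ} (g : GL (Fin n) K) (hdet : Valued.v (g : Matrix (Fin n) (Fin n) K).det = 1) :
    g ∈ glInt n K ↔ ∀ i j, Valued.v ((g : Matrix (Fin n) (Fin n) K) i j) ≤ 1 := by
  refine ⟨fun hg i j => ((mem_glInt_iff_forall_v_le_one g).1 hg).1 i j, fun h => ?_⟩
  exact mem_glInt_of_isIntegralMatrix (fun i j => (v_le_one_iff_mem_integer _).1 (h i j)) ((v_eq_one_iff_valuation_eq_one _).1 hdet)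

/-- A matrix with `v`-integral entries and unit determinant IS (the coercion of) an element of `GL_n(𝒪)`. [cite: Serre1979, Ch. II §1] -/
theorem exists_mem_glInt_coe_eq_of_forall_v_le_one {n : ℕ} {h : Matrix (Fin n) (Fin n) K} (h1 : ∀ i j, Valued.v (h i j) ≤ 1)
    (h2 : Valued.v h.det = 1) : ∃ γ : GL (Fin n) K, γ ∈ glInt n K ∧ (γ : Matrix (Fin n) (Fin n) K) = h := by
  have hdet : h.det ≠ 0 := fun h0 => by rw [h0, map_zero] at h2; exact zero_ne_one h2
  refine ⟨Matrix.GeneralLinearGroup.mkOfDetNeZero h hdet, ?_, rfl⟩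
  exact (mem_glInt_iff_forall_v_le_one_of_v_det_eq_one _ h2).2 h1

end Bridge

/-! ## §2 Diagonal bookkeeping -/

section Diagonal

variable {K : Type*} [Field K] [Valued K ℤᵐ⁰]

/-- `diag(1,a)⁻¹ · M · diag(1,a)` and `diag(1,a′)⁻¹ · M · diag(1,a′)` have the same entry valuations when `v a = v a′` — so only `ord a` matters in the
level tests. [cite: Serre1980Trees, Ch. II §1.1–§1.3] -/
theorem forall_v_conj_diagonal_le_one_iff_of_v_eq {a a' : K} (h : Valued.v a = Valued.v a') (M : Matrix (Fin 2) (Fin 2) K) :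
    (∀ i j, Valued.v ((diagonal ![1, a⁻¹] * M * diagonal ![1, a]) i j) ≤ 1) ↔
      ∀ i j, Valued.v ((diagonal ![1, a'⁻¹] * M * diagonal ![1, a']) i j) ≤ 1 := by
  have key : ∀ i j, Valued.v ((diagonal ![1, a⁻¹] * M * diagonal ![1, a]) i j) = Valued.v ((diagonal ![1, a'⁻¹] * M * diagonal ![1, a']) i j) := by
    intro i j
    rw [diagonal_mul_mul_diagonal_apply, diagonal_mul_mul_diagonal_apply, map_mul, map_mul, map_mul, map_mul]
    fin_cases i <;> fin_cases j <;> simp [map_inv₀, h]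
  simp only [key]

/-- For a UNIT `a`, `diag(1,a)⁻¹ · M · diag(1,a)` is integral iff `M` is. [cite: Serre1980Trees, Ch. II §1.1–§1.3] -/
theorem forall_v_conj_diagonal_le_one_iff_of_v_eq_one {a : K} (h : Valued.v a = 1) (M : Matrix (Fin 2) (Fin 2) K) :
    (∀ i j, Valued.v ((diagonal ![1, a⁻¹] * M * diagonal ![1, a]) i j) ≤ 1) ↔ ∀ i j, Valued.v (M i j) ≤ 1 := by
  have h1 : Valued.v a = Valued.v (1 : K) := by rw [h, map_one]
  rw [forall_v_conj_diagonal_le_one_iff_of_v_eq h1]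
  simp only [inv_one]
  have hd : diagonal ![(1 : K), 1] = 1 := by
    ext i j; fin_cases i <;> fin_cases j <;> simp
  rw [hd, Matrix.mul_one, Matrix.one_mul]

omit [Valued K ℤᵐ⁰] in
/-- Undoing the conjugation: `diag(1,α)⁻¹ · (diag(1,α) · u · diag(1,α)⁻¹) · diag(1,α) = u` (`α ≠ 0`). [cite: Serre1980Trees, Ch. II §1.1–§1.3] -/
theorem diagonal_inv_mul_conj_diagonal_mul_diagonal {α : K} (hα : α ≠ 0) (u : Matrix (Fin 2) (Fin 2) K) :
    diagonal ![1, α⁻¹] * (diagonal ![1, α] * u * diagonal ![1, α⁻¹]) * diagonal ![1, α] = u := by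
  ext i j
  rw [diagonal_mul_mul_diagonal_apply, diagonal_mul_mul_diagonal_apply]
  fin_cases i <;> fin_cases j <;> simp [hα]
  field_simp

omit [Valued K ℤᵐ⁰] in
/-- Composing conjugations: `diag(1,η)⁻¹ · (diag(1,α)⁻¹ · M · diag(1,α)) · diag(1,η) = diag(1,αη)⁻¹ · M · diag(1,αη)`. [cite: Serre1980Trees, Ch. II §1.1–§1.3] -/
theorem diagonal_inv_mul_conj_diagonal_inv_mul_diagonal (α η : K) (M : Matrix (Fin 2) (Fin 2) K) :
    diagonal ![1, η⁻¹] * (diagonal ![1, α⁻¹] * M * diagonal ![1, α]) * diagonal ![1, η] =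
      diagonal ![1, (α * η)⁻¹] * M * diagonal ![1, α * η] := by
  ext i j
  rw [diagonal_mul_mul_diagonal_apply, diagonal_mul_mul_diagonal_apply, diagonal_mul_mul_diagonal_apply]
  fin_cases i <;> fin_cases j <;> simp [_root_.mul_inv_rev] <;> ring

end Diagonal

end Literature.NumberTheory.Automorphic

namespace Literature.NumberTheory.Automorphic.UnitaryGroup

/-! ## §3 `|det u| = 1` on `U(σ, Φ₂)` -/

section UnitaryDet

variable {K : Type*} [Field K] [Valued K ℤᵐ⁰] (σ : K →+* K)

/-- **`|det u| = 1` on `U(σ, Φ₂)`** for a valuation-preserving `σ`: `det u · σ(det u) = 1` (★ `det_mul_map_det_eq_one_of_mem_unitaryGroupOfForm_antidiag_two`)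
gives `v(det u)² = 1`. [cite: Rogawski1990, §3.6 p. 31] -/
theorem v_det_eq_one_of_mem_unitaryGroupOfForm_antidiag_two (hσv : ∀ x, Valued.v (σ x) = Valued.v x) {u : GL (Fin 2) K}
    (hu : u ∈ unitaryGroupOfForm σ !![(0 : K), 1; 1, 0]) : Valued.v (u : Matrix (Fin 2) (Fin 2) K).det = 1 := by
  have h := congrArg Valued.v (det_mul_map_det_eq_one_of_mem_unitaryGroupOfForm_antidiag_two σ hu)
  rw [map_mul, hσv, map_one, ← pow_two] at h
  have h' : Valued.v (u : Matrix (Fin 2) (Fin 2) K).det ^ 2 = exp (2 • (0 : ℤ)) := by rw [h, smul_zero, WithZero.exp_zero]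
  rw [eq_exp_of_pow_eq_exp_nsmul two_ne_zero h', WithZero.exp_zero]

/-- **`|det (diag(1,α) u diag(1,α)⁻¹)| = 1`** for `u ∈ U(σ, Φ₂)`, `α ≠ 0` — the hypothesis `hdet` of the level criteria for `M = s · ι(g)` of ★
`exists_conj_diagonal_eq_smul_map_toPlace`. [cite: Rogawski1990, §3.6 p. 31] -/
theorem v_det_conj_diagonal_eq_one_of_mem_unitaryGroupOfForm_antidiag_two (hσv : ∀ x, Valued.v (σ x) = Valued.v x) {u : GL (Fin 2) K}
    (hu : u ∈ unitaryGroupOfForm σ !![(0 : K), 1; 1, 0]) {α : K} (hα0 : α ≠ 0) :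
    Valued.v (diagonal ![1, α] * (u : Matrix (Fin 2) (Fin 2) K) * diagonal ![1, α⁻¹]).det = 1 := by
  have hD1 : (diagonal ![(1 : K), α]).det = α := by rw [det_diagonal, Fin.prod_univ_two]; simp
  have hD2 : (diagonal ![(1 : K), α⁻¹]).det = α⁻¹ := by rw [det_diagonal, Fin.prod_univ_two]; simp
  rw [det_mul, det_mul, hD1, hD2, mul_right_comm, mul_inv_cancel₀ hα0, one_mul]
  exact v_det_eq_one_of_mem_unitaryGroupOfForm_antidiag_two σ hσv hu

end UnitaryDet

/-! ## §4 At a non-split place of a quadratic extension of number fields -/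

section Place

variable {F E : Type} [Field F] [NumberField F] [Field E] [NumberField E] [Algebra F E] [Algebra.IsQuadraticExtension F E]
  (c : E ≃ₐ[F] E) {v : HeightOneSpectrum (𝓞 F)} (w : PlacesOver E v)

omit [NumberField F] [Algebra.IsQuadraticExtension F E] in
/-- `e(w ∣ v) ≠ 0` — the hypothesis `he` of the VERTEX LEVEL criterion for `ι = toPlace v w` (★ `valued_toPlace`). [cite: NeukirchANT1999, Ch. I §8 Prop. (8.2)] -/
theorem ramificationIdx'_placesOver_ne_zero : v.asIdeal.ramificationIdx' w.1.asIdeal ≠ 0 := by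
  haveI := PlacesOver.liesOver w
  exact Ideal.IsDedekindDomain.ramificationIdx'_ne_zero_of_liesOver w.1.asIdeal v.ne_bot

/-- **At a RAMIFIED non-split place `ι_w` squares valuations**: `v_w(ι_w y) = v_v(y)²` (★ `valued_toPlace` + ★ `ramificationIdx'_eq_two_of_ne_one`) — the
hypothesis `hι` of the EDGE LEVEL criterion. [cite: NeukirchANT1999, Ch. II §6] -/
theorem valued_toPlace_eq_pow_two_of_ramified (hc : c ≠ 1) (hw : c • w.1 = w.1) (he : v.asIdeal.ramificationIdx' w.1.asIdeal ≠ 1)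
    (y : v.adicCompletion F) : Valued.v (toPlace v w y) = Valued.v y ^ 2 := by
  rw [valued_toPlace, Liu2021.LemD1IndexedNonVacuityRamifiedPlace.ramificationIdx'_eq_two_of_ne_one E v c hc w hw he]

end Place

end Literature.NumberTheory.Automorphic.UnitaryGroup
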